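import Mathlib
import Summits.Ventures.PercRepro2.CrossAPrimeVMarkedTwoRouteConn
import Summits.Ventures.PercRepro2.CrossAPrimeVMarkedCutMark

/-!
# The v-marked vdB–Kahn inequality when `v` is a two-route mark between the root and `b`
(blind cell PercRepro2, p5 g41; S4 §2.4 (s) addendum 61)

The companion of `CrossAPrimeVMarkedTwoRoute`: the mark `v` has exactly the two edges `fa = {v, a₁}`
and `fb = {v, b}` (the other 4-vertex member of the open class, the 4-cycle `a₁–o–b–v–a₁` with `v`
ADJACENT to the root, is the smallest instance).  With `σ = Function.update (Function.update ω fa false) fb false`, `O = {a₁ ↔ o in σ}`,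
`B = {a₁ ↔ b in σ}` and the TWO-CLUSTER event `W = {b ↔ o in σ}`:

  `o ∈ A ⟺ O ∨ (fa ∧ fb ∧ W)`, `b ∈ A ⟺ B ∨ (fa ∧ fb)`, `v ∈ A ⟺ fa ∨ (fb ∧ B)`

(`conn_rootRoute_o / _b / _v`), so with `t = p fa`, `β = p fb`, `x = P(O)`, `y = P(B)`, `r = P(O ∩ B)`,
`w = P(Oᶜ ∩ W)` the seven masses are explicit and, with `H = r − xy ≥ 0` (Harris on `G − v`) and
`K = w(1 − y) ≥ 0`,

  `RHS − LHS = (1−t)²β·H + 2t(1−t)[(1−β)² + 2β(1−β) + β²/2]·H + t(1−t)β(1−β + β)·K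
               + 2t²(1−β)²·H + 2t²β(1−β)·(H + K) ≥ 0`

(`rootRoute_algebra`, a polynomial identity) — **`vMarkedVdBK_of_rootRoute`**.  The mass `w` of the
two-cluster event `o ↔ b` off the root's cluster enters only through `K ≥ 0`: no correlation input
beyond Harris on `G − v` is needed.  Own work; standard axioms.
-/

namespace Summit.Ventures.PercRepro2

open CrossAPrimeVMarked CrossAPrimeVMarkedCut CrossAPrimeVMarkedLeaf CrossAPrimeIsolatedFlip OneEdge
  CrossAPrimeVMarkedPendantRoot CrossAPrimeVMarkedCutMark CrossAPrimeVMarkedTwoRoute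

namespace CrossAPrimeVMarkedRootRoute

variable {V : Type*} {E : Type*} [Fintype E] [DecidableEq E] [Fintype V] [DecidableEq V]
  {R : Type*} [Field R] [LinearOrder R] [IsStrictOrderedRing R]
variable {ends : E → Sym2 V}

section Conn

variable {fa fb : E} {a₁ v o b : V}

omit [Fintype E] [Fintype V] [DecidableEq V] in
/-- Both edges open: `a₁ ↔ o` iff `a₁ ↔ o` or `b ↔ o` off `v`; `a₁ ↔ b` and `a₁ ↔ v` hold. -/
lemma conn_both_open_root {σ : Config E} (hfa : ends fa = s(v, a₁)) (hfb : ends fb = s(v, b))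
    (hiso : ∀ e, v ∈ ends e → σ e = false) (hav : a₁ ≠ v) (hov : o ≠ v) (hbv : b ≠ v) :
    (Conn ends (Function.update (Function.update σ fa true) fb true) a₁ o ↔
        Conn ends σ a₁ o ∨ Conn ends σ b o) ∧
      Conn ends (Function.update (Function.update σ fa true) fb true) a₁ b ∧
      Conn ends (Function.update (Function.update σ fa true) fb true) a₁ v := by
  have P := conn_pendant_update hfa hiso hav
  set σ₁ := Function.update σ fa true with hσ₁
  have e_ao : Conn ends σ₁ a₁ o ↔ Conn ends σ a₁ o := P.1 a₁ o hav hov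
  have e_ab : Conn ends σ₁ a₁ b ↔ Conn ends σ a₁ b := P.1 a₁ b hav hbv
  have e_bo : Conn ends σ₁ b o ↔ Conn ends σ b o := P.1 b o hbv hov
  have e_vo : Conn ends σ₁ v o ↔ Conn ends σ a₁ o := P.2 o hov
  have e_av : Conn ends σ₁ a₁ v := conn_symm ((P.2 a₁ hav).2 (conn_refl ends σ a₁))
  refine ⟨?_, ?_, ?_⟩
  · rw [conn_update_true_iff hfb σ₁ a₁ o, e_ao, e_bo, e_ab, e_vo]
    constructor
    · rintro (h | ⟨-, h⟩ | ⟨-, h⟩)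
      · exact Or.inl h
      · exact Or.inr h
      · exact Or.inl h
    · rintro (h | h)
      · exact Or.inl h
      · exact Or.inr (Or.inl ⟨e_av, h⟩)
  · rw [conn_update_true_iff hfb σ₁ a₁ b]
    exact Or.inr (Or.inl ⟨e_av, conn_refl ends σ₁ b⟩)
  · rw [conn_update_true_iff hfb σ₁ a₁ v]
    exact Or.inl e_av

omit [Fintype E] [Fintype V] [DecidableEq V] in
/-- **The root-route mark, the mark `o`**: `a₁ ↔ o ⟺ (a₁ ↔ o off v) ∨ (fa ∧ fb ∧ b ↔ o off v)`. -/
theorem conn_rootRoute_o (hfa : ends fa = s(v, a₁)) (hfb : ends fb = s(v, b))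
    (hv : ∀ e, v ∈ ends e → e = fa ∨ e = fb) (hne : fa ≠ fb) (hav : a₁ ≠ v) (hov : o ≠ v)
    (hbv : b ≠ v) (ω : Config E) :
    Conn ends ω a₁ o ↔ Conn ends (Function.update (Function.update ω fa false) fb false) a₁ o ∨
      (ω fa = true ∧ ω fb = true ∧ Conn ends (Function.update (Function.update ω fa false) fb false) b o) := by
  have hiso := closeTwo_isolated hv hne ω
  have R := eq_of_coins hne ω
  have Pb := conn_pendant_update hfb hiso hbv
  have Pa := conn_pendant_update hfa hiso hav
  cases ho : ω fa <;> cases hb : ω fb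
  · simp only [Bool.false_eq_true, false_and, or_false]
    conv_lhs => rw [R.1 ho hb]
  · simp only [Bool.false_eq_true, false_and, or_false]
    conv_lhs => rw [R.2.1 ho hb]
    exact Pb.1 a₁ o hav hov
  · simp only [Bool.false_eq_true, false_and, and_false, or_false]
    conv_lhs => rw [R.2.2.1 ho hb]
    exact Pa.1 a₁ o hav hov
  · simp only [true_and]
    conv_lhs => rw [R.2.2.2 ho hb]
    exact (conn_both_open_root hfa hfb hiso hav hov hbv).1

omit [Fintype E] [Fintype V] [DecidableEq V] in
/-- The root-route mark, the mark `b`: `a₁ ↔ b ⟺ (a₁ ↔ b off v) ∨ (fa ∧ fb)`. -/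
theorem conn_rootRoute_b (hfa : ends fa = s(v, a₁)) (hfb : ends fb = s(v, b))
    (hv : ∀ e, v ∈ ends e → e = fa ∨ e = fb) (hne : fa ≠ fb) (hav : a₁ ≠ v) (hov : o ≠ v)
    (hbv : b ≠ v) (ω : Config E) :
    Conn ends ω a₁ b ↔ Conn ends (Function.update (Function.update ω fa false) fb false) a₁ b ∨ (ω fa = true ∧ ω fb = true) := by
  have hiso := closeTwo_isolated hv hne ω
  have R := eq_of_coins hne ω
  have Pb := conn_pendant_update hfb hiso hbv
  have Pa := conn_pendant_update hfa hiso hav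
  cases ho : ω fa <;> cases hb : ω fb
  · simp only [Bool.false_eq_true, false_and, or_false]
    conv_lhs => rw [R.1 ho hb]
  · simp only [Bool.false_eq_true, false_and, or_false]
    conv_lhs => rw [R.2.1 ho hb]
    exact Pb.1 a₁ b hav hbv
  · simp only [Bool.false_eq_true, and_false, or_false]
    conv_lhs => rw [R.2.2.1 ho hb]
    exact Pa.1 a₁ b hav hbv
  · simp only [and_self, or_true, iff_true]
    rw [R.2.2.2 ho hb]
    exact (conn_both_open_root hfa hfb hiso hav hov hbv).2.1

omit [Fintype E] [Fintype V] [DecidableEq V] in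
/-- The root-route mark, the mark `v`: `a₁ ↔ v ⟺ fa ∨ (fb ∧ a₁ ↔ b off v)`. -/
theorem conn_rootRoute_v (hfa : ends fa = s(v, a₁)) (hfb : ends fb = s(v, b))
    (hv : ∀ e, v ∈ ends e → e = fa ∨ e = fb) (hne : fa ≠ fb) (hav : a₁ ≠ v) (hov : o ≠ v)
    (hbv : b ≠ v) (ω : Config E) :
    Conn ends ω a₁ v ↔ ω fa = true ∨ (ω fb = true ∧ Conn ends (Function.update (Function.update ω fa false) fb false) a₁ b) := by
  have hiso := closeTwo_isolated hv hne ω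
  have R := eq_of_coins hne ω
  have Pb := conn_pendant_update hfb hiso hbv
  have Pa := conn_pendant_update hfa hiso hav
  cases ho : ω fa <;> cases hb : ω fb
  · conv_lhs => rw [R.1 ho hb]
    simp only [Bool.false_eq_true, false_and, or_self, iff_false]
    exact fun h => hav (eq_of_conn_of_isolated hiso (conn_symm h))
  · simp only [Bool.false_eq_true, true_and, false_or]
    conv_lhs => rw [R.2.1 ho hb]
    exact ⟨fun h => conn_symm ((Pb.2 a₁ hav).1 (conn_symm h)),
      fun h => conn_symm ((Pb.2 a₁ hav).2 (conn_symm h))⟩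
  · simp only [true_or, iff_true]
    rw [R.2.2.1 ho hb]
    exact conn_symm ((Pa.2 a₁ hav).2 (conn_refl ends _ a₁))
  · simp only [true_or, iff_true]
    rw [R.2.2.2 ho hb]
    exact (conn_both_open_root hfa hfb hiso hav hov hbv).2.2

end Conn

section Coins

variable {fa fb : E}

omit [Fintype V] [DecidableEq V] [LinearOrder R] [IsStrictOrderedRing R] in
/-- A coin event (determined by `{fa, fb}`) is independent of an event determined by the other edges. -/
lemma prob_coin_inter_rr (p : E → R) {C X : Set (Config E)}
    (hC : DependsOn (· ∈ C) ({fa, fb} : Set E)) (hX : DependsOn (· ∈ X) (({fa, fb} : Set E)ᶜ)) :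
    prob p (C ∩ X) = prob p C * prob p X :=
  prob_inter_eq_mul_of_dependsOn p disjoint_compl_right hC hX

omit [Fintype V] [DecidableEq V] [LinearOrder R] [IsStrictOrderedRing R] in
/-- `P(fa open, fb open) = p fa · p fb`. -/
lemma prob_open_open_rr (p : E → R) (hne : fa ≠ fb) :
    prob p (openEdge fa ∩ openEdge fb) = p fa * p fb := by
  rw [prob_inter_eq_mul_of_dependsOn p (Set.disjoint_singleton.2 hne) (dependsOn_openEdge fa)
    (dependsOn_openEdge fb), prob_openEdge, prob_openEdge]

omit [Fintype V] [DecidableEq V] [LinearOrder R] [IsStrictOrderedRing R] in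
/-- `P(fa open, fb closed) = p fa · (1 − p fb)`. -/
lemma prob_open_closed_rr (p : E → R) (hne : fa ≠ fb) :
    prob p (openEdge fa ∩ (openEdge fb)ᶜ) = p fa * (1 - p fb) := by
  rw [← closedEdge_eq_compl, prob_inter_eq_mul_of_dependsOn p (Set.disjoint_singleton.2 hne)
    (dependsOn_openEdge fa) (dependsOn_closedEdge fb), prob_openEdge, prob_closedEdge]

omit [Fintype E] [DecidableEq E] [Fintype V] [DecidableEq V] in
/-- `{fa open, fb open}` is determined by `{fa, fb}`. -/
lemma dependsOn_pair_rr (fa fb : E) :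
    DependsOn (· ∈ openEdge fa ∩ openEdge fb) ({fa, fb} : Set E) := by
  have := dependsOn_inter (dependsOn_openEdge fa) (dependsOn_openEdge fb)
  rwa [Set.singleton_union] at this

omit [Fintype E] [DecidableEq E] [Fintype V] [DecidableEq V] in
/-- `{fa open, fb closed}` is determined by `{fa, fb}`. -/
lemma dependsOn_open_closed_rr (fa fb : E) :
    DependsOn (· ∈ openEdge fa ∩ (openEdge fb)ᶜ) ({fa, fb} : Set E) := by
  have := dependsOn_inter (dependsOn_openEdge fa) (dependsOn_compl (dependsOn_openEdge fb))
  rwa [Set.singleton_union] at this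

omit [Fintype E] [DecidableEq E] [Fintype V] [DecidableEq V] in
/-- `{fa open}` is determined by `{fa, fb}`. -/
lemma dependsOn_left_rr (fa fb : E) : DependsOn (· ∈ openEdge fa) ({fa, fb} : Set E) :=
  DependsOn.mono (by simp) (dependsOn_openEdge fa)

omit [Fintype E] [DecidableEq E] [Fintype V] [DecidableEq V] in
/-- `{fb open}` is determined by `{fa, fb}`. -/
lemma dependsOn_right_rr (fa fb : E) : DependsOn (· ∈ openEdge fb) ({fa, fb} : Set E) :=
  DependsOn.mono (by simp) (dependsOn_openEdge fb)

end Coins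

section Masses

variable {fa fb : E} {O B W : Set (Config E)}

omit [Fintype V] [DecidableEq V] [LinearOrder R] [IsStrictOrderedRing R] in
/-- `P(R_o) = 1 − P(O) − tβ·P(Oᶜ ∩ W)`. -/
lemma rr_mass_o (p : E → R) (hne : fa ≠ fb) (dO : DependsOn (· ∈ O) (({fa, fb} : Set E)ᶜ))
    (dW : DependsOn (· ∈ W) (({fa, fb} : Set E)ᶜ)) :
    prob p (O ∪ (openEdge fa ∩ openEdge fb ∩ W))ᶜ =
      1 - prob p O - p fa * p fb * prob p (Oᶜ ∩ W) := by
  have dOW : DependsOn (· ∈ O ∩ W) (({fa, fb} : Set E)ᶜ) := by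
    have := dependsOn_inter dO dW
    rwa [Set.union_self] at this
  have iW : prob p (W ∩ O) + prob p (W ∩ Oᶜ) = prob p W := prob_inter_add_prob_inter_compl p W O
  rw [prob_compl, prob_union_eq]
  have e : O ∩ (openEdge fa ∩ openEdge fb ∩ W) = (openEdge fa ∩ openEdge fb) ∩ (O ∩ W) := by
    ext ω; simp only [Set.mem_inter_iff]; tauto
  rw [e, prob_coin_inter_rr p (dependsOn_pair_rr fa fb) dOW,
    prob_coin_inter_rr p (dependsOn_pair_rr fa fb) dW, prob_open_open_rr p hne,
    Set.inter_comm W O, Set.inter_comm W Oᶜ] at *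
  linear_combination (p fa * p fb) * iW

omit [Fintype V] [DecidableEq V] [LinearOrder R] [IsStrictOrderedRing R] in
/-- `P(R_b ∩ L) = t(1 − β)·P(Bᶜ)`. -/
lemma rr_mass_bL (p : E → R) (hne : fa ≠ fb) (dB : DependsOn (· ∈ B) (({fa, fb} : Set E)ᶜ)) :
    prob p ((B ∪ (openEdge fa ∩ openEdge fb))ᶜ ∩ (openEdge fa ∪ (openEdge fb ∩ B))) =
      p fa * (1 - p fb) * prob p Bᶜ := by
  have e : (B ∪ (openEdge fa ∩ openEdge fb))ᶜ ∩ (openEdge fa ∪ (openEdge fb ∩ B)) =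
      (openEdge fa ∩ (openEdge fb)ᶜ) ∩ Bᶜ := by
    ext ω
    simp only [Set.mem_inter_iff, Set.mem_union, Set.mem_compl_iff]
    tauto
  rw [e, prob_coin_inter_rr p (dependsOn_open_closed_rr fa fb) (dependsOn_compl dB),
    prob_open_closed_rr p hne]

omit [Fintype V] [DecidableEq V] [LinearOrder R] [IsStrictOrderedRing R] in
/-- `P(R_b) = P(Bᶜ)(1 − tβ)`. -/
lemma rr_mass_b (p : E → R) (hne : fa ≠ fb) (dB : DependsOn (· ∈ B) (({fa, fb} : Set E)ᶜ)) :
    prob p (B ∪ (openEdge fa ∩ openEdge fb))ᶜ = prob p Bᶜ * (1 - p fa * p fb) := by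
  rw [Set.compl_union, prob_inter_compl_eq, Set.inter_comm Bᶜ,
    prob_coin_inter_rr p (dependsOn_pair_rr fa fb) (dependsOn_compl dB), prob_open_open_rr p hne]
  ring

omit [Fintype V] [DecidableEq V] [LinearOrder R] [IsStrictOrderedRing R] in
/-- `P(R_o ∩ L) = t·P(Oᶜ) + β·P(Oᶜ ∩ B) − tβ·P(Oᶜ ∩ B) − tβ·P(Oᶜ ∩ W)`. -/
lemma rr_mass_oL (p : E → R) (hne : fa ≠ fb) (dO : DependsOn (· ∈ O) (({fa, fb} : Set E)ᶜ))
    (dB : DependsOn (· ∈ B) (({fa, fb} : Set E)ᶜ)) (dW : DependsOn (· ∈ W) (({fa, fb} : Set E)ᶜ)) :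
    prob p ((O ∪ (openEdge fa ∩ openEdge fb ∩ W))ᶜ ∩ (openEdge fa ∪ (openEdge fb ∩ B))) =
      p fa * prob p Oᶜ + p fb * prob p (Oᶜ ∩ B) - p fa * p fb * prob p (Oᶜ ∩ B) -
        p fa * p fb * prob p (Oᶜ ∩ W) := by
  have dOcB : DependsOn (· ∈ Oᶜ ∩ B) (({fa, fb} : Set E)ᶜ) := by
    have := dependsOn_inter (dependsOn_compl dO) dB
    rwa [Set.union_self] at this
  have dOcW : DependsOn (· ∈ Oᶜ ∩ W) (({fa, fb} : Set E)ᶜ) := by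
    have := dependsOn_inter (dependsOn_compl dO) dW
    rwa [Set.union_self] at this
  -- `R_o ∩ L = (Oᶜ ∩ L) ∖ (fa ∩ fb ∩ W)` and `Oᶜ ∩ L = (fa ∩ Oᶜ) ∪ ((fb ∩ (Oᶜ ∩ B))`
  have e : (O ∪ (openEdge fa ∩ openEdge fb ∩ W))ᶜ ∩ (openEdge fa ∪ (openEdge fb ∩ B)) =
      ((openEdge fa ∩ Oᶜ) ∪ (openEdge fb ∩ (Oᶜ ∩ B))) ∩
        ((openEdge fa ∩ openEdge fb) ∩ (Oᶜ ∩ W))ᶜ := by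
    ext ω
    simp only [Set.mem_inter_iff, Set.mem_union, Set.mem_compl_iff]
    tauto
  have e2 : ((openEdge fa ∩ Oᶜ) ∪ (openEdge fb ∩ (Oᶜ ∩ B))) ∩
      ((openEdge fa ∩ openEdge fb) ∩ (Oᶜ ∩ W)) = (openEdge fa ∩ openEdge fb) ∩ (Oᶜ ∩ W) := by
    ext ω
    simp only [Set.mem_inter_iff, Set.mem_union, Set.mem_compl_iff]
    tauto
  have e3 : (openEdge fa ∩ Oᶜ) ∩ (openEdge fb ∩ (Oᶜ ∩ B)) =
      (openEdge fa ∩ openEdge fb) ∩ (Oᶜ ∩ B) := by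
    ext ω; simp only [Set.mem_inter_iff, Set.mem_compl_iff]; tauto
  rw [e, prob_inter_compl_eq, e2, prob_union_eq, e3,
    prob_coin_inter_rr p (dependsOn_left_rr fa fb) (dependsOn_compl dO),
    prob_coin_inter_rr p (dependsOn_right_rr fa fb) dOcB,
    prob_coin_inter_rr p (dependsOn_pair_rr fa fb) dOcB,
    prob_coin_inter_rr p (dependsOn_pair_rr fa fb) dOcW, prob_open_open_rr p hne, prob_openEdge,
    prob_openEdge]

omit [Fintype V] [DecidableEq V] [LinearOrder R] [IsStrictOrderedRing R] in
/-- `P(L) = t + β·P(B) − tβ·P(B)`. -/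
lemma rr_mass_L (p : E → R) (hne : fa ≠ fb) (dB : DependsOn (· ∈ B) (({fa, fb} : Set E)ᶜ)) :
    prob p (openEdge fa ∪ (openEdge fb ∩ B)) = p fa + p fb * prob p B - p fa * p fb * prob p B := by
  rw [prob_union_eq, prob_coin_inter_rr p (dependsOn_right_rr fa fb) dB, ← Set.inter_assoc,
    prob_coin_inter_rr p (dependsOn_pair_rr fa fb) dB, prob_open_open_rr p hne, prob_openEdge,
    prob_openEdge]

omit [Fintype V] [DecidableEq V] [LinearOrder R] [IsStrictOrderedRing R] in
/-- `P(R_{o,b}) = P(Oᶜ ∩ Bᶜ)(1 − tβ)`. -/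
lemma rr_mass_ob (p : E → R) (hne : fa ≠ fb) (dO : DependsOn (· ∈ O) (({fa, fb} : Set E)ᶜ))
    (dB : DependsOn (· ∈ B) (({fa, fb} : Set E)ᶜ)) :
    prob p ((O ∪ (openEdge fa ∩ openEdge fb ∩ W))ᶜ ∩ (B ∪ (openEdge fa ∩ openEdge fb))ᶜ) =
      prob p (Oᶜ ∩ Bᶜ) * (1 - p fa * p fb) := by
  have dOcBc : DependsOn (· ∈ Oᶜ ∩ Bᶜ) (({fa, fb} : Set E)ᶜ) := by
    have := dependsOn_inter (dependsOn_compl dO) (dependsOn_compl dB)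
    rwa [Set.union_self] at this
  have e : (O ∪ (openEdge fa ∩ openEdge fb ∩ W))ᶜ ∩ (B ∪ (openEdge fa ∩ openEdge fb))ᶜ =
      (Oᶜ ∩ Bᶜ) ∩ (openEdge fa ∩ openEdge fb)ᶜ := by
    ext ω
    simp only [Set.mem_inter_iff, Set.mem_union, Set.mem_compl_iff]
    tauto
  rw [e, prob_inter_compl_eq, Set.inter_comm (Oᶜ ∩ Bᶜ),
    prob_coin_inter_rr p (dependsOn_pair_rr fa fb) dOcBc, prob_open_open_rr p hne]
  ring

omit [Fintype V] [DecidableEq V] [LinearOrder R] [IsStrictOrderedRing R] in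
/-- `P(R_{o,b} ∩ L) = P(Oᶜ ∩ Bᶜ)·t(1 − β)`. -/
lemma rr_mass_obL (p : E → R) (hne : fa ≠ fb) (dO : DependsOn (· ∈ O) (({fa, fb} : Set E)ᶜ))
    (dB : DependsOn (· ∈ B) (({fa, fb} : Set E)ᶜ)) :
    prob p ((O ∪ (openEdge fa ∩ openEdge fb ∩ W))ᶜ ∩ (B ∪ (openEdge fa ∩ openEdge fb))ᶜ ∩
      (openEdge fa ∪ (openEdge fb ∩ B))) = prob p (Oᶜ ∩ Bᶜ) * (p fa * (1 - p fb)) := by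
  have dOcBc : DependsOn (· ∈ Oᶜ ∩ Bᶜ) (({fa, fb} : Set E)ᶜ) := by
    have := dependsOn_inter (dependsOn_compl dO) (dependsOn_compl dB)
    rwa [Set.union_self] at this
  have e : (O ∪ (openEdge fa ∩ openEdge fb ∩ W))ᶜ ∩ (B ∪ (openEdge fa ∩ openEdge fb))ᶜ ∩
      (openEdge fa ∪ (openEdge fb ∩ B)) = (openEdge fa ∩ (openEdge fb)ᶜ) ∩ (Oᶜ ∩ Bᶜ) := by
    ext ω
    simp only [Set.mem_inter_iff, Set.mem_union, Set.mem_compl_iff]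
    tauto
  rw [e, prob_coin_inter_rr p (dependsOn_open_closed_rr fa fb) dOcBc, prob_open_closed_rr p hne]
  ring

omit [Fintype E] [DecidableEq E] [Fintype V] [DecidableEq V] in
/-- The algebraic core (a polynomial identity with nine nonnegative terms):
`H = r − xy ≥ 0`, `K = w(1 − y) ≥ 0`, `0 ≤ t, β ≤ 1`. -/
lemma rootRoute_algebra {t β x y r w : R} (ht0 : 0 ≤ t) (ht1 : t ≤ 1) (hβ0 : 0 ≤ β) (hβ1 : β ≤ 1)
    (hy1 : y ≤ 1) (hw : 0 ≤ w) (hH : x * y ≤ r) :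
    (1 - x - t * β * w) * (t * (1 - β) * (1 - y)) +
        (1 - y) * (1 - t * β) *
          (t * (1 - x) + β * (y - r) - t * β * (y - r) - t * β * w) ≤
      (t + β * y - t * β * y) * ((1 - x - y + r) * (1 - t * β)) +
        (1 - x - y + r) * (t * (1 - β)) := by
  have hH' : 0 ≤ r - x * y := sub_nonneg.2 hH
  have hK : 0 ≤ w * (1 - y) := mul_nonneg hw (sub_nonneg.2 hy1)
  have t' : 0 ≤ 1 - t := sub_nonneg.2 ht1
  have β' : 0 ≤ 1 - β := sub_nonneg.2 hβ1
  have c1 := mul_nonneg (mul_nonneg (mul_nonneg (mul_nonneg t' t') hβ0) β') hH'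
  have c2 := mul_nonneg (mul_nonneg (mul_nonneg t' t') (mul_nonneg hβ0 hβ0)) hH'
  have c3 := mul_nonneg (mul_nonneg (mul_nonneg ht0 t') (mul_nonneg β' β')) hH'
  have c4 := mul_nonneg (mul_nonneg (mul_nonneg ht0 t') (mul_nonneg hβ0 β')) hH'
  have c5 := mul_nonneg (mul_nonneg (mul_nonneg ht0 t') (mul_nonneg hβ0 β')) hK
  have c6 := mul_nonneg (mul_nonneg (mul_nonneg ht0 t') (mul_nonneg hβ0 hβ0)) hH'
  have c7 := mul_nonneg (mul_nonneg (mul_nonneg ht0 t') (mul_nonneg hβ0 hβ0)) hK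
  have c8 := mul_nonneg (mul_nonneg (mul_nonneg ht0 ht0) (mul_nonneg β' β')) hH'
  have c9 := mul_nonneg (mul_nonneg (mul_nonneg ht0 ht0) (mul_nonneg hβ0 β')) (add_nonneg hH' hK)
  linarith only [c1, c2, c3, c4, c5, c6, c7, c8, c9]

end Masses

omit [Fintype V] in
/-- **(★₂′) for a root-route mark**: `fa = {v, a₁}`, `fb = {v, b}` the only edges at `v`,
`v ∉ {a₁, o, b}`. -/
theorem vMarkedVdBK_of_rootRoute {fa fb : E} {a₁ v o b : V} {p : E → R} (hp : IsProbVec p)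
    (hfa : ends fa = s(v, a₁)) (hfb : ends fb = s(v, b)) (hv : ∀ e, v ∈ ends e → e = fa ∨ e = fb)
    (hne : fa ≠ fb) (hav : a₁ ≠ v) (hov : o ≠ v) (hbv : b ≠ v) : VMarkedVdBK p ends a₁ v o b := by
  unfold VMarkedVdBK
  set O : Set (Config E) := {ω | Function.update (Function.update ω fa false) fb false ∈ connEvent ends a₁ o} with hO
  set B : Set (Config E) := {ω | Function.update (Function.update ω fa false) fb false ∈ connEvent ends a₁ b} with hB
  set W : Set (Config E) := {ω | Function.update (Function.update ω fa false) fb false ∈ connEvent ends b o} with hW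
  have eo : connEvent ends a₁ o = O ∪ (openEdge fa ∩ openEdge fb ∩ W) := by
    ext ω
    simp only [mem_connEvent, Set.mem_union, Set.mem_inter_iff, hO, hW, mem_openEdge,
      Set.mem_setOf_eq]
    rw [conn_rootRoute_o hfa hfb hv hne hav hov hbv ω]
    tauto
  have eb : connEvent ends a₁ b = B ∪ (openEdge fa ∩ openEdge fb) := by
    ext ω
    simp only [mem_connEvent, Set.mem_union, Set.mem_inter_iff, hB, mem_openEdge, Set.mem_setOf_eq]
    rw [conn_rootRoute_b hfa hfb hv hne hav hov hbv ω]
  have ev : connEvent ends a₁ v = openEdge fa ∪ (openEdge fb ∩ B) := by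
    ext ω
    simp only [mem_connEvent, Set.mem_union, Set.mem_inter_iff, hB, mem_openEdge, Set.mem_setOf_eq]
    rw [conn_rootRoute_v hfa hfb hv hne hav hov hbv ω]
  have dO : DependsOn (· ∈ O) (({fa, fb} : Set E)ᶜ) := dependsOn_closeTwo fa fb (connEvent ends a₁ o)
  have dB : DependsOn (· ∈ B) (({fa, fb} : Set E)ᶜ) := dependsOn_closeTwo fa fb (connEvent ends a₁ b)
  have dW : DependsOn (· ∈ W) (({fa, fb} : Set E)ᶜ) := dependsOn_closeTwo fa fb (connEvent ends b o)
  have uO : IsUpperSet O := fun ω ω' h hω => conn_mono (closeTwo_mono fa fb h) hω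
  have uB : IsUpperSet B := fun ω ω' h hω => conn_mono (closeTwo_mono fa fb h) hω
  clear_value O B W
  rw [avoidAll_pair, avoidAll_singleton, avoidAll_singleton, eo, eb, ev]
  have hH : prob p O * prob p B ≤ prob p (O ∩ B) := prob_mul_prob_le_prob_inter hp uO uB
  rw [rr_mass_o p hne dO dW, rr_mass_bL p hne dB, rr_mass_b p hne dB, rr_mass_oL p hne dO dB dW,
    rr_mass_L p hne dB, rr_mass_ob p hne dO dB, rr_mass_obL p hne dO dB]
  -- the cells in terms of `x = P(O)`, `y = P(B)`, `r = P(O ∩ B)`, `w = P(Oᶜ ∩ W)`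
  have iOB : prob p (O ∩ B) + prob p (O ∩ Bᶜ) = prob p O := prob_inter_add_prob_inter_compl p O B
  have iBO : prob p (B ∩ O) + prob p (B ∩ Oᶜ) = prob p B := prob_inter_add_prob_inter_compl p B O
  have iOc : prob p (Oᶜ ∩ B) + prob p (Oᶜ ∩ Bᶜ) = prob p Oᶜ := prob_inter_add_prob_inter_compl p Oᶜ B
  have hOc : prob p Oᶜ = 1 - prob p O := prob_compl p O
  have hBc : prob p Bᶜ = 1 - prob p B := prob_compl p B
  have sBO : prob p (B ∩ O) = prob p (O ∩ B) := by rw [Set.inter_comm]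
  have sBOc : prob p (B ∩ Oᶜ) = prob p (Oᶜ ∩ B) := by rw [Set.inter_comm]
  have cp : prob p (Oᶜ ∩ B) = prob p B - prob p (O ∩ B) := by linarith only [iBO, sBO, sBOc]
  have ca : prob p (Oᶜ ∩ Bᶜ) = 1 - prob p O - prob p B + prob p (O ∩ B) := by
    linarith only [iOc, hOc, cp]
  rw [hOc, hBc, cp, ca]
  exact rootRoute_algebra (hp.nonneg fa) (hp.le_one fa) (hp.nonneg fb) (hp.le_one fb)
    (prob_le_one hp B) (prob_nonneg hp (Oᶜ ∩ W)) hH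

end CrossAPrimeVMarkedRootRoute

end Summit.Ventures.PercRepro2
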